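import Summits.CriticalPhenomena.Ising3DConformalLimit.Theorems.EnergyNotSigmaSquaredGapForcesFarMergingScreeningDefsAnnular

/-!
# Un-tilting from a Harris inequality for ONE decreasing/increasing pair
(line `screening-form-lemma-a1` of crux `GapForcesFarMerging`, item stmt-CriticalPhenomena-4468; lead seat a1; helper file of
the open stub `stub_untilt` (H) of the registered skeleton v3.3, second half of `AnnularDomination` — see
`Theorems/EnergyNotSigmaSquaredGapForcesFarMergingScreeningAnnularSplit.lean`)

The un-tilting stub (H) says that the screening tilt `W_k = screenWeight n 2^k 0 e₂ (dn M) = 𝟙[e₂,dn M ∉ C]·S(C_(2^k))`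
— a DECREASING function of the one-strand cluster — cannot inflate a small UNtilted annular hazard
`1 − annScreen = E[1 − annWeight_k]` — the mean of an INCREASING function of the cluster — into a large tilted one.
If the one-strand trace law `P^(0,up M;∅)_(Λ_n)` satisfied Harris' inequality `E[W·G] ≤ E[W]·E[G]` for this single pair
(`W = W_k` decreasing, `G = 1 − annWeight_k` increasing), (H) would follow at once with `μ = ν`. This file records exactly
that: `untilt_of_harrisPair : (Harris for the pair, octave ∧ bulk) → (H)`. Positive association of random-current traces
is false with sources (lead c1's 4-cycle) and is not available even for the sourceless double current (Aizenman–Duminil-Copin–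
Tassion–Warzel, Invent. Math. 216 (2019), §1.2: "absence of positive association (in particular the FKG inequality) for this
model"); the pair inequality below is therefore an OPEN, much weaker target — one decreasing/increasing pair, asymptotically,
at the scales of an opaque octave. [cite: Harris1960; FortuinKasteleynGinibre1971]
-/

noncomputable section

namespace Summit.CriticalPhenomena.Ising3DConformalLimit.EnergyNotSigmaSquaredGapForcesFarMerging

open scoped symmDiff ENNReal
open MeasureTheory Filter Finset
open Literature.Probability.LatticeModels Literature.Probability.Percolation
open Summit.CriticalPhenomena.Ising3DConformalLimit.Theorems.GapForcesFarMerging.Negative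
  (e₁ e₂ cc2 xR up dn FarMergingShape SinglePinchLawShape)
open Summit.CriticalPhenomena.Ising3DConformalLimit.GapForcesFarMergingScreening

/-- **Un-tilting from Harris' inequality for the pair (screening tilt, annular hazard)**: if
`E[W_k·(1 − annWeight_k)] ≤ E[W_k]·(1 − annScreen)` (octave) and the analogous outer inequality (bulk) hold at all large
scales, then the un-tilting stub (H) holds with `μ = ν`: from `ν·A ≤ E[W·G] ≤ A·(1 − annScreen)` and `A = E[W_k] > 0`
divide by `A`. Pure algebra on top of the pair inequality. [cite: Harris1960] -/
theorem untilt_of_harrisPair :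
    ((∀ᶠ k : ℕ in atTop, ∀ K : ℕ, k < K → ∀ᶠ n : ℕ in atTop, ∫ ω, screenWeight n (2 ^ k) 0 e₂ (dn (2 ^ (K + 3))) ω * (1 - annWeight n k 0 e₂ (dn (2 ^ (K + 3))) ω) ∂(sourcedDoubleCurrentLaw 3 n (criticalBeta 3) ({0} ∆ {up (2 ^ (K + 3))}) ∅) ≤ pinchScreen n (2 ^ k) (2 ^ (K + 3)) * (1 - annScreen n k 0 (up (2 ^ (K + 3))) e₂ (dn (2 ^ (K + 3))))) ∧ (∀ᶠ K : ℕ in atTop, ∀ᶠ n : ℕ in atTop, ∫ ω, screenWeight n (2 ^ K) 0 e₂ (dn (2 ^ (K + 3))) ω * (1 - outerWeight n K 0 e₂ (dn (2 ^ (K + 3))) ω) ∂(sourcedDoubleCurrentLaw 3 n (criticalBeta 3) ({0} ∆ {up (2 ^ (K + 3))}) ∅) ≤ pinchScreen n (2 ^ K) (2 ^ (K + 3)) * (1 - outerScreen n K 0 (up (2 ^ (K + 3))) e₂ (dn (2 ^ (K + 3)))))) →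
    (∀ ν : ℝ, 0 < ν → ∃ μ : ℝ, 0 < μ ∧ (∀ᶠ k : ℕ in atTop, ∀ K : ℕ, k < K → ∀ᶠ n : ℕ in atTop, 0 < pinchScreen n (2 ^ k) (2 ^ (K + 3)) → ν * pinchScreen n (2 ^ k) (2 ^ (K + 3)) ≤ ∫ ω, screenWeight n (2 ^ k) 0 e₂ (dn (2 ^ (K + 3))) ω * (1 - annWeight n k 0 e₂ (dn (2 ^ (K + 3))) ω) ∂(sourcedDoubleCurrentLaw 3 n (criticalBeta 3) ({0} ∆ {up (2 ^ (K + 3))}) ∅) → annScreen n k 0 (up (2 ^ (K + 3))) e₂ (dn (2 ^ (K + 3))) ≤ 1 - μ) ∧ (∀ᶠ K : ℕ in atTop, ∀ᶠ n : ℕ in atTop, 0 < pinchScreen n (2 ^ K) (2 ^ (K + 3)) → ν * pinchScreen n (2 ^ K) (2 ^ (K + 3)) ≤ ∫ ω, screenWeight n (2 ^ K) 0 e₂ (dn (2 ^ (K + 3))) ω * (1 - outerWeight n K 0 e₂ (dn (2 ^ (K + 3))) ω) ∂(sourcedDoubleCurrentLaw 3 n (criticalBeta 3) ({0} ∆ {up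 (2 ^ (K + 3))}) ∅) → outerScreen n K 0 (up (2 ^ (K + 3))) e₂ (dn (2 ^ (K + 3))) ≤ 1 - μ)) := by
  rintro ⟨hPo, hPb⟩ ν hν
  refine ⟨ν, hν, ?_, ?_⟩
  · filter_upwards [hPo] with k hk K hkK
    filter_upwards [hk K hkK] with n hn hpos hνle
    have h := hνle.trans hn
    -- `ν·A ≤ A·(1 − annScreen)` with `A > 0`
    nlinarith
  · filter_upwards [hPb] with K hK
    filter_upwards [hK] with n hn hpos hνle
    have h := hνle.trans hn
    nlinarith

end Summit.CriticalPhenomena.Ising3DConformalLimit.EnergyNotSigmaSquaredGapForcesFarMerging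

end
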